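import Summits.Ventures.Crystal3D.Theorems.StickyWulffConstantCoaxialWallLawPayerTwinMulti
import Summits.Ventures.Crystal3D.Theorems.StickyWulffConstantCoaxialWallLawOneFccLayerLines
import Summits.Ventures.Crystal3D.Theorems.StickyWulffConstantCoaxialWallLawOnSiteTools
import Summits.Ventures.Crystal3D.Theorems.StickyWulffConstantGenericWallFloorCapStartBarlowStep
import Literature.Algebra.EuclideanLattices.FccBccLattices
import HarnessLib

/-!
# The ONE-FCC F_layer: FRAME AND WINDOW IDENTITIES for the two-family ledger (file (k₁))

HONEST FRAMING. Venture `Summits/Ventures/Crystal3D` (cell `crystal3d-full`); helper `--supports` the crux `CoaxialWallLaw`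
(stmt-Ventures-19481, REGISTERED line `WallLedgerF`) in its role as owner of lane T's debt T-F2 / F_layer, OneFcc half (cf-p1 (civ)/(cxx);
memo HOME/wall-19481-p1/g16/TWO-FAMILY-LEDGER-g16.md).  Elementary identities (no census, no plates); standard axioms; nothing about the crux
is claimed; F-C1 not moved.

With `Fr ∈ {L, basalMirror ≫ L}` the root frame of family A, `FrB = (H ≫ Fr) ≫ basalMirror` that of family B (`H` the half-turn about
`e₃`), `L' = L ≫ basalMirror`, `ν₂ = (L⁻¹ e₃)₂`:
* `frame_apply_basal`, `frB_apply_basal` — on basal slots `Fr r = L r`, `FrB r = −L' r`;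
* `inPlaneRoots_frB`, `frB_apply_two` — families A and B have the SAME rising in-plane roots and rises;
* `symm_e₃_two_trans_basalMirror`, `symm_e₃_two_sq_frame`, `symm_e₃_two_sq_frB`, `symm_two_trans_basalMirror_shift` — the tilt `ν₂²`
  and the plane phase are the same for `L`, `L'`, `Fr`, `FrB` (up to the bookkept signs);
* `four_div_sqrt_le_phi` — the line density `Φ = 4 (Σ_r (Fr r)₂)/(√3 (1 − ν₂²)) ≥ 4/√(1 − ν₂²)` (`sum_inPlane_rising_ge`);
  `sum_inPlaneRoots_apply_two_le` — `Σ_r (Fr r)₂ ≤ 12 √(1 − ν₂²)`;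
* `norm_le_of_lat_height`, `layerIndex_mem_Icc` — the layer-index window of a bounded site;
* `oneFcc_weights` — `[¬(σ(k−1) = −t ∧ σ k = −t)] + [σ(k−1) = t ∧ σ k = t] = [σ(k−1) = t] + [σ k = t]` for a Hägg word and `t = ±1`.
WHAT THIS IS NOT: any count; F-C1 not moved.
-/

noncomputable section

namespace Summit.Ventures.Crystal3D.Theorems

open Summit.Ventures.Crystal3D Finset
open Literature.MathematicalPhysics.StatisticalMechanics (IsHaggSeq basalMirror basalMirror_apply_coord basalMirror_basalMirror
  barlowPos barlowPos_apply_two)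
open scoped InnerProductSpace

/-- The basal mirror is its own inverse. -/
theorem basalMirror_symm_apply (y : EuclideanSpace ℝ (Fin 3)) : basalMirror.symm y = basalMirror y := by
  have h := LinearIsometryEquiv.symm_apply_apply basalMirror (basalMirror y)
  rwa [basalMirror_basalMirror] at h

/-- The root frame of family A agrees with the presentation frame on basal slots. -/
theorem frame_apply_basal {L Fr : EuclideanSpace ℝ (Fin 3) ≃ₗᵢ[ℝ] EuclideanSpace ℝ (Fin 3)} {t : ℤ}
    (hFr : (t = 1 ∧ Fr = L) ∨ (t = -1 ∧ Fr = basalMirror.trans L)) {r : EuclideanSpace ℝ (Fin 3)} (hr : r 2 = 0) :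
    Fr r = L r := by
  rcases hFr with ⟨-, h⟩ | ⟨-, h⟩
  · rw [h]
  · rw [h, LinearIsometryEquiv.trans_apply, basalMirror_of_inPlane hr]

/-- The root frame of family B on basal slots: `FrB r = −(L ≫ bM) r`. -/
theorem frB_apply_basal {L Fr : EuclideanSpace ℝ (Fin 3) ≃ₗᵢ[ℝ] EuclideanSpace ℝ (Fin 3)}
    (hFrL : ∀ r : EuclideanSpace ℝ (Fin 3), r 2 = 0 → Fr r = L r) {r : EuclideanSpace ℝ (Fin 3)} (hr : r 2 = 0) :
    ((((ℝ ∙ EuclideanSpace.single (2 : Fin 3) (1 : ℝ)).reflection).trans Fr).trans basalMirror) r =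
      -(L.trans basalMirror) r := by
  rw [LinearIsometryEquiv.trans_apply, LinearIsometryEquiv.trans_apply, LinearIsometryEquiv.trans_apply, halfTurn_of_basal hr,
    map_neg, hFrL r hr, map_neg]

/-- The rise of family B's root equals family A's. -/
theorem frB_apply_two {L Fr : EuclideanSpace ℝ (Fin 3) ≃ₗᵢ[ℝ] EuclideanSpace ℝ (Fin 3)}
    (hFrL : ∀ r : EuclideanSpace ℝ (Fin 3), r 2 = 0 → Fr r = L r) {r : EuclideanSpace ℝ (Fin 3)} (hr : r 2 = 0) :
    (((((ℝ ∙ EuclideanSpace.single (2 : Fin 3) (1 : ℝ)).reflection).trans Fr).trans basalMirror) r) 2 = (Fr r) 2 := by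
  rw [frB_apply_basal hFrL hr, PiLp.neg_apply, LinearIsometryEquiv.trans_apply, basalMirror_apply_coord, if_pos rfl, neg_neg,
    hFrL r hr]

/-- Families A and B have the same rising in-plane roots. -/
theorem inPlaneRoots_frB {L Fr : EuclideanSpace ℝ (Fin 3) ≃ₗᵢ[ℝ] EuclideanSpace ℝ (Fin 3)}
    (hFrL : ∀ r : EuclideanSpace ℝ (Fin 3), r 2 = 0 → Fr r = L r) :
    inPlaneRoots ((((ℝ ∙ EuclideanSpace.single (2 : Fin 3) (1 : ℝ)).reflection).trans Fr).trans basalMirror) 1 = inPlaneRoots Fr 1 := by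
  unfold inPlaneRoots
  refine filter_congr fun r _ => ?_
  constructor
  · rintro ⟨hr, hup⟩; exact ⟨hr, by rwa [frB_apply_two hFrL hr] at hup⟩
  · rintro ⟨hr, hup⟩; exact ⟨hr, by rwa [frB_apply_two hFrL hr]⟩

/-- `((L ≫ bM)⁻¹ e₃)₂ = −(L⁻¹ e₃)₂`. -/
theorem symm_e₃_two_trans_basalMirror (L : EuclideanSpace ℝ (Fin 3) ≃ₗᵢ[ℝ] EuclideanSpace ℝ (Fin 3)) :
    ((L.trans basalMirror).symm (EuclideanSpace.single (2 : Fin 3) (1 : ℝ))) 2 =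
      -(L.symm (EuclideanSpace.single (2 : Fin 3) (1 : ℝ))) 2 := by
  have hbe : basalMirror (EuclideanSpace.single (2 : Fin 3) (1 : ℝ)) = -EuclideanSpace.single (2 : Fin 3) (1 : ℝ) := by
    ext l
    rw [basalMirror_apply_coord, PiLp.neg_apply]
    split_ifs with h
    · rw [h]
    · fin_cases l <;> simp_all
  have h1 : (L.trans basalMirror).symm (EuclideanSpace.single (2 : Fin 3) (1 : ℝ)) =
      L.symm (basalMirror.symm (EuclideanSpace.single (2 : Fin 3) (1 : ℝ))) := rfl
  have h2 : basalMirror.symm (EuclideanSpace.single (2 : Fin 3) (1 : ℝ)) = basalMirror (EuclideanSpace.single (2 : Fin 3) (1 : ℝ)) :=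
    basalMirror_symm_apply _
  rw [h1, h2, hbe, map_neg, PiLp.neg_apply]

/-- `(Fr⁻¹ e₃)₂² = (L⁻¹ e₃)₂²` for `Fr ∈ {L, bM ≫ L}`. -/
theorem symm_e₃_two_sq_frame {L Fr : EuclideanSpace ℝ (Fin 3) ≃ₗᵢ[ℝ] EuclideanSpace ℝ (Fin 3)} {t : ℤ}
    (hFr : (t = 1 ∧ Fr = L) ∨ (t = -1 ∧ Fr = basalMirror.trans L)) :
    (Fr.symm (EuclideanSpace.single (2 : Fin 3) (1 : ℝ))) 2 ^ 2 = (L.symm (EuclideanSpace.single (2 : Fin 3) (1 : ℝ))) 2 ^ 2 := by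
  rcases hFr with ⟨-, h⟩ | ⟨-, h⟩
  · rw [h]
  · rw [h]
    have : (basalMirror.trans L).symm (EuclideanSpace.single (2 : Fin 3) (1 : ℝ)) =
        basalMirror.symm (L.symm (EuclideanSpace.single (2 : Fin 3) (1 : ℝ))) := rfl
    rw [this, basalMirror_symm_apply, basalMirror_apply_coord, if_pos rfl, neg_sq]

/-- `(FrB⁻¹ e₃)₂² = (Fr⁻¹ e₃)₂²` for `FrB = (H ≫ Fr) ≫ bM`. -/
theorem symm_e₃_two_sq_frB (Fr : EuclideanSpace ℝ (Fin 3) ≃ₗᵢ[ℝ] EuclideanSpace ℝ (Fin 3)) :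
    (((((ℝ ∙ EuclideanSpace.single (2 : Fin 3) (1 : ℝ)).reflection).trans Fr).trans basalMirror).symm
        (EuclideanSpace.single (2 : Fin 3) (1 : ℝ))) 2 ^ 2 =
      (Fr.symm (EuclideanSpace.single (2 : Fin 3) (1 : ℝ))) 2 ^ 2 := by
  rw [symm_e₃_two_trans_basalMirror, neg_sq]
  have : ((((ℝ ∙ EuclideanSpace.single (2 : Fin 3) (1 : ℝ)).reflection).trans Fr).symm (EuclideanSpace.single (2 : Fin 3) (1 : ℝ))) =
      ((ℝ ∙ EuclideanSpace.single (2 : Fin 3) (1 : ℝ)).reflection).symm (Fr.symm (EuclideanSpace.single (2 : Fin 3) (1 : ℝ))) := rfl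
  rw [this, Submodule.reflection_symm, (halfTurn_coord _).2.2]

/-- The plane phase of the mirrored presentation: `((L ≫ bM)⁻¹ (bM s + h e₃))₂ = (L⁻¹ s)₂ − h (L⁻¹ e₃)₂`. -/
theorem symm_two_trans_basalMirror_shift (L : EuclideanSpace ℝ (Fin 3) ≃ₗᵢ[ℝ] EuclideanSpace ℝ (Fin 3))
    (s : EuclideanSpace ℝ (Fin 3)) (h : ℝ) :
    ((L.trans basalMirror).symm (basalMirror s + h • EuclideanSpace.single (2 : Fin 3) (1 : ℝ))) 2 =
      (L.symm s) 2 - h * (L.symm (EuclideanSpace.single (2 : Fin 3) (1 : ℝ))) 2 := by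
  have hbe : basalMirror (EuclideanSpace.single (2 : Fin 3) (1 : ℝ)) = -EuclideanSpace.single (2 : Fin 3) (1 : ℝ) := by
    ext l
    rw [basalMirror_apply_coord, PiLp.neg_apply]
    split_ifs with h
    · rw [h]
    · fin_cases l <;> simp_all
  have h1 : ∀ y, (L.trans basalMirror).symm y = L.symm (basalMirror.symm y) := fun y => rfl
  have h2 : ∀ y, basalMirror.symm y = basalMirror y := basalMirror_symm_apply
  rw [h1, h2, map_add, basalMirror_basalMirror, LinearIsometryEquiv.map_smul, hbe, map_add, LinearIsometryEquiv.map_smul, map_neg,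
    PiLp.add_apply, PiLp.smul_apply, PiLp.neg_apply, smul_eq_mul]
  ring

/-- **The line density of the in-plane roots**: `4/√(1 − ν₂²) ≤ Φ = 4 (Σ_r (Fr r)₂)/(√3 (1 − ν₂²))` (for `ν₂² < 1`). -/
theorem four_div_sqrt_le_phi {L Fr : EuclideanSpace ℝ (Fin 3) ≃ₗᵢ[ℝ] EuclideanSpace ℝ (Fin 3)} {t : ℤ}
    (hFr : (t = 1 ∧ Fr = L) ∨ (t = -1 ∧ Fr = basalMirror.trans L))
    (hS2 : 0 < 1 - (L.symm (EuclideanSpace.single (2 : Fin 3) (1 : ℝ))) 2 ^ 2) :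
    4 / Real.sqrt (1 - (L.symm (EuclideanSpace.single (2 : Fin 3) (1 : ℝ))) 2 ^ 2) ≤
      4 * (∑ r ∈ inPlaneRoots Fr 1, (Fr r) 2) /
        (Real.sqrt 3 * (1 - (L.symm (EuclideanSpace.single (2 : Fin 3) (1 : ℝ))) 2 ^ 2)) := by
  -- the root sum of `Fr`
  have key := sum_inPlane_rising_ge Fr (fun b => if b then ((ℝ ∙ EuclideanSpace.single (2 : Fin 3) (1 : ℝ)).reflection).trans Fr
    else Fr) (Or.inl ⟨rfl, rfl⟩) (n := Fr (EuclideanSpace.single (2 : Fin 3) (1 : ℝ))) (Or.inl rfl)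
  have hfilter : fccSlots.filter (fun r =>
      ⟪(fun b => if b then ((ℝ ∙ EuclideanSpace.single (2 : Fin 3) (1 : ℝ)).reflection).trans Fr else Fr) false r,
        Fr (EuclideanSpace.single (2 : Fin 3) (1 : ℝ))⟫_ℝ = 0 ∧
      0 < ((fun b => if b then ((ℝ ∙ EuclideanSpace.single (2 : Fin 3) (1 : ℝ)).reflection).trans Fr else Fr) false r) 2) =
      inPlaneRoots Fr 1 := by
    unfold inPlaneRoots
    refine filter_congr fun r _ => ?_
    simp only [Bool.false_eq_true, ↓reduceIte, LinearIsometryEquiv.inner_map_map, inner_single_two_one, one_mul]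
  rw [hfilter] at key
  simp only [Bool.false_eq_true, ↓reduceIte] at key
  -- `⟪Fr e₃, e₃⟫² = ν₂²`
  have hax : ⟪Fr (EuclideanSpace.single (2 : Fin 3) (1 : ℝ)), EuclideanSpace.single (2 : Fin 3) (1 : ℝ)⟫_ℝ ^ 2 =
      (L.symm (EuclideanSpace.single (2 : Fin 3) (1 : ℝ))) 2 ^ 2 := by
    have h1 : ⟪Fr (EuclideanSpace.single (2 : Fin 3) (1 : ℝ)), EuclideanSpace.single (2 : Fin 3) (1 : ℝ)⟫_ℝ =
        (Fr.symm (EuclideanSpace.single (2 : Fin 3) (1 : ℝ))) 2 := by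
      rw [apply_two_eq_inner_symm Fr.symm, LinearIsometryEquiv.symm_symm, real_inner_comm]
    rw [h1, symm_e₃_two_sq_frame hFr]
  rw [hax] at key
  -- divide
  set S2 : ℝ := 1 - (L.symm (EuclideanSpace.single (2 : Fin 3) (1 : ℝ))) 2 ^ 2 with hS2def
  have hS : 0 < Real.sqrt S2 := Real.sqrt_pos.2 hS2
  have h3 : 0 < Real.sqrt 3 := Real.sqrt_pos.2 (by norm_num)
  have hSS : Real.sqrt S2 * Real.sqrt S2 = S2 := Real.mul_self_sqrt hS2.le
  have key' := mul_le_mul_of_nonneg_right key hS.le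
  rw [div_le_div_iff₀ hS (mul_pos h3 hS2)]
  nlinarith [key', hSS]

/-- Each rise is at most the tilt sine: `Σ_r (Fr r)₂ ≤ 12 √(1 − ν₂²)`. -/
theorem sum_inPlaneRoots_apply_two_le {L Fr : EuclideanSpace ℝ (Fin 3) ≃ₗᵢ[ℝ] EuclideanSpace ℝ (Fin 3)} {t : ℤ}
    (hFr : (t = 1 ∧ Fr = L) ∨ (t = -1 ∧ Fr = basalMirror.trans L)) :
    ∑ r ∈ inPlaneRoots Fr 1, (Fr r) 2 ≤ 12 * Real.sqrt (1 - (L.symm (EuclideanSpace.single (2 : Fin 3) (1 : ℝ))) 2 ^ 2) := by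
  set e₃ : EuclideanSpace ℝ (Fin 3) := EuclideanSpace.single (2 : Fin 3) (1 : ℝ) with he₃
  set μ : EuclideanSpace ℝ (Fin 3) := Fr.symm e₃ with hμ
  have hμ1 : μ 0 ^ 2 + μ 1 ^ 2 + μ 2 ^ 2 = 1 := by
    rw [← Literature.Algebra.EuclideanLattices.norm_sq_fin_three, hμ, LinearIsometryEquiv.norm_map, PiLp.norm_single, norm_one,
      one_pow]
  have hμ2 : μ 2 ^ 2 = (L.symm e₃) 2 ^ 2 := symm_e₃_two_sq_frame hFr
  have hrise : ∀ r ∈ inPlaneRoots Fr 1, (Fr r) 2 ≤ Real.sqrt (1 - (L.symm e₃) 2 ^ 2) := by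
    intro r hr
    obtain ⟨hrS, hr2, -⟩ := mem_filter.1 hr
    have hr1 : r 0 ^ 2 + r 1 ^ 2 + r 2 ^ 2 = 1 := by
      rw [← Literature.Algebra.EuclideanLattices.norm_sq_fin_three, norm_eq_one_of_mem_fccSlots hrS, one_pow]
    have hinner : (Fr r) 2 = r 0 * μ 0 + r 1 * μ 1 := by
      rw [apply_two_eq_inner_symm, Literature.Algebra.EuclideanLattices.inner_fin_three, hr2, zero_mul, add_zero]
    rw [hinner]
    refine (le_abs_self _).trans (Real.abs_le_sqrt ?_)
    rw [← hμ2]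
    nlinarith [sq_nonneg (r 0 * μ 1 - r 1 * μ 0), hr1, hμ1, hr2]
  have hcard : (inPlaneRoots Fr 1).card ≤ 12 := (card_le_card (filter_subset _ _)).trans (by rw [card_fccSlots])
  have h0 : 0 ≤ Real.sqrt (1 - (L.symm e₃) 2 ^ 2) := Real.sqrt_nonneg _
  calc ∑ r ∈ inPlaneRoots Fr 1, (Fr r) 2 ≤ ∑ r ∈ inPlaneRoots Fr 1, Real.sqrt (1 - (L.symm e₃) 2 ^ 2) := sum_le_sum hrise
    _ = (inPlaneRoots Fr 1).card * Real.sqrt (1 - (L.symm e₃) 2 ^ 2) := by rw [sum_const, nsmul_eq_mul]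
    _ ≤ 12 * Real.sqrt (1 - (L.symm e₃) 2 ^ 2) := by
        have : ((inPlaneRoots Fr 1).card : ℝ) ≤ 12 := by exact_mod_cast hcard
        nlinarith

/-- A point of lateral radius `≤ ρ` and height `|p₂| ≤ T` has norm `≤ ρ + T`. -/
theorem norm_le_of_lat_height (p : EuclideanSpace ℝ (Fin 3)) {ρ T : ℝ} (hρ : 0 ≤ ρ) (hT : 0 ≤ T)
    (hlat : p 0 ^ 2 + p 1 ^ 2 ≤ ρ ^ 2) (hz : |p 2| ≤ T) : ‖p‖ ≤ ρ + T := by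
  have h := Literature.Algebra.EuclideanLattices.norm_sq_fin_three p
  have h2 : p 2 ^ 2 ≤ T ^ 2 := by rw [← sq_abs]; exact pow_le_pow_left₀ (abs_nonneg _) hz 2
  rw [← Real.sqrt_sq (norm_nonneg p), ← Real.sqrt_sq (by positivity : 0 ≤ ρ + T)]
  exact Real.sqrt_le_sqrt (by nlinarith)

/-- **The layer-index window of a bounded site**: a site of layer `k` of the presentation `(L, s)` within norm `Rtot` has
`k ∈ [⌈(−(L⁻¹s)₂ − Rtot)/d⌉, ⌊(−(L⁻¹s)₂ + Rtot)/d⌋]`. -/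
theorem layerIndex_mem_Icc (L : EuclideanSpace ℝ (Fin 3) ≃ₗᵢ[ℝ] EuclideanSpace ℝ (Fin 3)) (s y : EuclideanSpace ℝ (Fin 3)) {k : ℤ}
    (hy : y 2 = k * Real.sqrt (2 / 3)) {Rtot : ℝ} (hp : ‖L y + s‖ ≤ Rtot) :
    k ∈ Finset.Icc ⌈(-(L.symm s) 2 - Rtot) / Real.sqrt (2 / 3)⌉ ⌊(-(L.symm s) 2 + Rtot) / Real.sqrt (2 / 3)⌋ := by
  have hd : (0 : ℝ) < Real.sqrt (2 / 3) := Real.sqrt_pos.2 (by norm_num)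
  have hc : (L.symm (L y + s)) 2 = k * Real.sqrt (2 / 3) + (L.symm s) 2 := by
    rw [map_add, LinearIsometryEquiv.symm_apply_apply, PiLp.add_apply, hy]
  have habs : |(L.symm (L y + s)) 2| ≤ ‖L.symm (L y + s)‖ := by
    have h := Literature.Algebra.EuclideanLattices.norm_sq_fin_three (L.symm (L y + s))
    rw [← Real.sqrt_sq_eq_abs, ← Real.sqrt_sq (norm_nonneg _)]
    exact Real.sqrt_le_sqrt (by nlinarith [sq_nonneg ((L.symm (L y + s)) 0), sq_nonneg ((L.symm (L y + s)) 1)])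
  rw [LinearIsometryEquiv.norm_map, hc] at habs
  have h1 := (abs_le.1 (habs.trans hp))
  rw [Finset.mem_Icc, Int.ceil_le, Int.le_floor, div_le_iff₀ hd, le_div_iff₀ hd]
  constructor <;> linarith [h1.1, h1.2]

/-- **The slab-index window of a bounded point**: a point of the open slab `i` of `(L, s)` within norm `Rtot` has
`i ∈ [⌈(−(L⁻¹s)₂ − Rtot)/d⌉ − 1, ⌊(−(L⁻¹s)₂ + Rtot)/d⌋]`. -/
theorem slabIndex_mem_Icc (L : EuclideanSpace ℝ (Fin 3) ≃ₗᵢ[ℝ] EuclideanSpace ℝ (Fin 3)) (s r : EuclideanSpace ℝ (Fin 3)) {i : ℤ}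
    (hr : (i : ℝ) * Real.sqrt (2 / 3) < r 2 ∧ r 2 < ((i : ℝ) + 1) * Real.sqrt (2 / 3)) {Rtot : ℝ} (hq : ‖L r + s‖ ≤ Rtot) :
    i ∈ Finset.Icc (⌈(-(L.symm s) 2 - Rtot) / Real.sqrt (2 / 3)⌉ - 1) ⌊(-(L.symm s) 2 + Rtot) / Real.sqrt (2 / 3)⌋ := by
  have hd : (0 : ℝ) < Real.sqrt (2 / 3) := Real.sqrt_pos.2 (by norm_num)
  have hc : (L.symm (L r + s)) 2 = r 2 + (L.symm s) 2 := by
    rw [map_add, LinearIsometryEquiv.symm_apply_apply, PiLp.add_apply]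
  have habs : |(L.symm (L r + s)) 2| ≤ ‖L.symm (L r + s)‖ := by
    have h := Literature.Algebra.EuclideanLattices.norm_sq_fin_three (L.symm (L r + s))
    rw [← Real.sqrt_sq_eq_abs, ← Real.sqrt_sq (norm_nonneg _)]
    exact Real.sqrt_le_sqrt (by nlinarith [sq_nonneg ((L.symm (L r + s)) 0), sq_nonneg ((L.symm (L r + s)) 1)])
  rw [LinearIsometryEquiv.norm_map, hc] at habs
  have h1 := (abs_le.1 (habs.trans hq))
  rw [Finset.mem_Icc, Int.le_floor]
  constructor
  · have h2 : ⌈(-(L.symm s) 2 - Rtot) / Real.sqrt (2 / 3)⌉ ≤ i + 1 := by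
      rw [Int.ceil_le, div_le_iff₀ hd]; push_cast; linarith [h1.1, hr.2]
    linarith
  · rw [le_div_iff₀ hd]; linarith [h1.2, hr.1]

/-- `[¬P] = 1 − [P]`. -/
theorem ite_not_one_zero (P : Prop) [Decidable P] : (if ¬ P then (1 : ℝ) else 0) = 1 - (if P then (1 : ℝ) else 0) := by
  split_ifs <;> norm_num

/-- **The weights of the ledger**: A-admissible + B-non-exit = the two charged-bilayer indicators. -/
theorem oneFcc_weights {σ : ℤ → ℤ} (hσ : IsHaggSeq σ) {t : ℤ} (ht : t = 1 ∨ t = -1) (k : ℤ) :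
    (if ¬ (σ (k - 1) = -t ∧ σ k = -t) then (1 : ℝ) else 0) + (if (σ (k - 1) = t ∧ σ k = t) then (1 : ℝ) else 0) =
      (if σ (k - 1) = t then (1 : ℝ) else 0) + (if σ k = t then (1 : ℝ) else 0) := by
  rcases hσ (k - 1) with h1 | h1 <;> rcases hσ k with h2 | h2 <;> rcases ht with rfl | rfl <;> simp [h1, h2]

end Summit.Ventures.Crystal3D.Theorems

end
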